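import Literature.Computability.AlgebraicComplexity.TokenExpansion
import HarnessLib

/-!
# The token expansion of a normalized circuit, II: product, coefficient and leaf nodes

The step `W_{k+1}(β) = RHS_{k+1}(β)` of the cut induction (`TokenExpansion.lean`) at a node `k`
of kind `mul a b`, `pass c a`, `leaf ℓ`: the fibre sum over the extensions `β' ∈ Ext_k β` has a
single non-vanishing term, the CONSISTENT extension `βmul β` (every demanded clone passes its
demand to all its children), with node product `1`, `c^{#demanded}`, `ℓ^{#demanded}`; the new
demand across the cut `k` is valid (children ranges lie inside the parent range and siblings of a
product clone have disjoint ranges `[c, c+fd a)`, `[c+fd a, c+fd a+fd b)`), and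
`∏_{children} val = ∏_{demanded} val_e k` by the node equation.

* `βmul`, `prodAt_βmul`, `prodAt_eq_zero_of_ne`, `valid_βmul`, `RHS_βmul`, `step_mul`;
* generic tokens `tokK`, `valid_βK`, `exists_tokK_of_ne`; `step_pass`; `step_leaf`.

## References

* G. Malod, N. Portier, *Characterizing Valiant's algebraic complexity classes*, J. Complexity
  24 (2008) 16–38: Lemma 2 (reduced circuits) and Thm. 2 with its proof (the local conditions
  (1)–(4) of a parse tree, pp. 8–9 of the MFCS 2006 version).
* P. Bürgisser, *On defining integers and proving arithmetic circuit lower bounds*,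
  Comput. Complexity 18 (2009) 81–103, Thm. 2.10 (ECCC TR06-113, p. 8).
-/

namespace Literature.Computability.AlgebraicComplexity

open Finset

universe u

namespace NCirc

variable {R : Type u} [CommRing R] (N : NCirc R) (D : ℕ) (hD : 1 ≤ D) (hm : 0 < N.m)

/-! ### Tokens of a node and their ranges -/

/-- A variable with source `k < m`, `k ≥ u`, is a token of a clone `(k, c)`. [folklore] -/
theorem exists_tok_of_src {k : ℕ} (hk : k < N.m) (hku : N.u ≤ k) (v : N.Var D) (hs : N.src D v = k) :
    ∃ τ : N.Tok D, v = Sum.inl τ ∧ τ.1.1 = N.cl D hk τ.1.1.2 := by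
  rcases v with τ | ⟨⟨⟩⟩ | q
  · refine ⟨τ, rfl, ?_⟩
    simp only [src] at hs
    unfold cl
    ext <;> simp [hs]
  · simp [src] at hs; omega
  · simp only [src] at hs
    have := q.1.1.isLt
    omega

/-- The range of the target of a token lies inside the range of its source clone. [cite: MalodPortier2008, Lemma 2] -/
theorem rangeOf_tgt_subset (τ : N.Tok D) :
    N.rangeOf (N.tgt D τ) ⊆ N.rangeOf (τ.1.1.1.val, τ.1.1.2.val) := by
  have h := N.tgt_spec D τ
  intro x hx
  unfold rangeOf at hx ⊢
  rw [Finset.mem_Ico] at hx ⊢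
  simp only at hx ⊢
  omega

/-- The two children of a product clone have disjoint ranges. [cite: MalodPortier2008, Lemma 2] -/
theorem disjoint_rangeOf_mul (τ τ' : N.Tok D) (hττ' : τ.1.1 = τ'.1.1) (hj : τ.1.2 ≠ τ'.1.2)
    {a b : ℕ} (hkind : N.kind τ.1.1.1.val = NK.mul a b) :
    Disjoint (N.rangeOf (N.tgt D τ)) (N.rangeOf (N.tgt D τ')) := by
  have e1 : N.tgt D τ = N.tgtOf τ.1.1.2.val τ.1.2.val (NK.mul a b) := by rw [tgt, hkind]
  have e2 : N.tgt D τ' = N.tgtOf τ.1.1.2.val τ'.1.2.val (NK.mul a b) := by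
    rw [tgt, ← hττ', hkind]
  rw [e1, e2]
  unfold tgtOf rangeOf
  rw [Finset.disjoint_left]
  intro x hx hx'
  have hj' : τ.1.2.val ≠ τ'.1.2.val := fun h => hj (Fin.ext h)
  have h2 : τ.1.2.val < 2 := τ.1.2.isLt
  have h2' : τ'.1.2.val < 2 := τ'.1.2.isLt
  split_ifs at hx hx' with h h' h' <;> simp only [Finset.mem_Ico] at hx hx' <;> omega

/-! ### The step at a product node -/

section StepMul

variable {k : ℕ} (hk : k < N.m) (hku : N.u ≤ k)

/-- **The consistent extension at a product node**: every demanded clone passes its demand to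
both children, nothing else is set at the node `k`. [cite: MalodPortier2008, Thm. 2] -/
noncomputable def βmul (β : N.Var D → Bool) : N.Var D → Bool := fun v =>
  match v with
  | Sum.inl τ => if τ.1.1.1.val = k then N.sdem D hk β τ.1.1.2
      else if k < τ.1.1.1.val then β (Sum.inl τ) else false
  | Sum.inr w => if k < N.src D (Sum.inr w) then β (Sum.inr w) else false

/-- `βmul` agrees with `β` above `k`. [folklore] -/
theorem βmul_above (β : N.Var D → Bool) (v : N.Var D) (hv : k < N.src D v) : N.βmul D hk β v = β v := by
  rcases v with τ | w
  · simp only [src] at hv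
    simp only [βmul]
    rw [if_neg (by omega), if_pos hv]
  · simp only [βmul]
    rw [if_pos hv]

/-- `βmul` vanishes below `k`. [folklore] -/
theorem βmul_below (β : N.Var D → Bool) (v : N.Var D) (hv : N.src D v < k) : N.βmul D hk β v = false := by
  rcases v with τ | w
  · simp only [src] at hv
    simp only [βmul]
    rw [if_neg (by omega), if_neg (by omega)]
  · simp only [βmul]
    rw [if_neg (by omega)]

/-- `βmul` on the tokens of node `k`. [folklore] -/
theorem βmul_tok (β : N.Var D → Bool) (c : Fin (D + 1)) (j : Fin 2)
    (h : N.CValid D (N.cl D hk c) ∧ j.val < (N.kind (N.cl D hk c).1.val).ar) :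
    N.βmul D hk β (Sum.inl ⟨(N.cl D hk c, j), h⟩) = N.sdem D hk β c := by
  simp [βmul, cl]

/-- `βmul ∈ Ext_k β`. [folklore] -/
theorem βmul_mem_Ext (β : N.Var D → Bool) : N.βmul D hk β ∈ N.Ext D k β := by
  unfold Ext
  rw [Finset.mem_filter]
  exact ⟨Finset.mem_univ _, fun v hv => N.βmul_above D hk β v (by omega), N.βmul_below D hk β⟩

end StepMul

section StepMul2

variable {k : ℕ} (hk : k < N.m) (hku : N.u ≤ k) {a b : ℕ} (hkind : N.kind k = NK.mul a b)
  (hroot : N.fd (N.m - 1) ≤ D)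

/-- The token variable `(k, c, j)` of a valid product clone. [folklore] -/
def tokMul (c : Fin (D + 1)) (hv : N.CValid D (N.cl D hk c)) (j : Fin 2) : N.Var D :=
  Sum.inl ⟨(N.cl D hk c, j), hv, by show j.val < (N.kind k).ar; rw [hkind]; exact j.isLt⟩

/-- The value of a valid product clone factor. [folklore] -/
theorem spec_cl_mul (c : Fin (D + 1)) (hv : N.CValid D (N.cl D hk c)) (b' : N.Var D → Bool) :
    (N.cloneKind D (N.cl D hk c)).spec b' =
      if b' (N.tokMul D hk hkind c hv 0) = (N.ins D (N.cl D hk c)).any b' ∧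
          b' (N.tokMul D hk hkind c hv 1) = (N.ins D (N.cl D hk c)).any b' then 1 else 0 := by
  rw [N.cloneKind_eq D _ hv (show N.kind (N.cl D hk c).1.val = NK.mul a b from hkind)]
  rfl

/-- **`prodAt` of the consistent extension is `1`.** [folklore] -/
theorem prodAt_βmul (hku : N.u ≤ k) (hkind : N.kind k = NK.mul a b) (F : Fin (N.mF D) → (N.Var D → Bool) → R)
    (hF : (N.FS D hD hm hroot).Admissible F)
    (β : N.Var D → Bool) (hval : N.Valid D (k + 1) β) : N.prodAt D F k (N.βmul D hk β) = 1 := by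
  rw [N.prodAt_eq D hk hku]
  refine Finset.prod_eq_one fun c _ => ?_
  rw [N.F_cl_eq_spec D hD hm hk hroot F hF β hval _ (fun v hv => N.βmul_above D hk β v hv)]
  by_cases hv : N.CValid D (N.cl D hk c)
  · rw [N.spec_cl_mul D hk hkind c hv, N.any_ins_congr D hk β _ (fun v hv => N.βmul_above D hk β v hv)]
    unfold tokMul
    rw [N.βmul_tok D hk, N.βmul_tok D hk, if_pos ⟨rfl, rfl⟩]
  · rw [N.cloneKind_of_not D _ hv]
    simp [FKind.spec]

/-- **Every other extension kills a product clone factor.** [folklore] -/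
theorem prodAt_eq_zero_of_ne (hku : N.u ≤ k) (hkind : N.kind k = NK.mul a b)
    (F : Fin (N.mF D) → (N.Var D → Bool) → R)
    (hF : (N.FS D hD hm hroot).Admissible F) (β : N.Var D → Bool) (hval : N.Valid D (k + 1) β)
    (β' : N.Var D → Bool) (hβ' : β' ∈ N.Ext D k β) (hne : β' ≠ N.βmul D hk β) :
    N.prodAt D F k β' = 0 := by
  unfold Ext at hβ'
  rw [Finset.mem_filter] at hβ'
  obtain ⟨-, hag, hzero⟩ := hβ'
  -- a variable where they differ has source `k`
  obtain ⟨v, hv⟩ : ∃ v, β' v ≠ N.βmul D hk β v := Function.ne_iff.1 hne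
  have hs : N.src D v = k := by
    by_contra hs
    rcases Nat.lt_or_gt_of_ne hs with hlt | hgt
    · exact hv (by rw [hzero v hlt, N.βmul_below D hk β v hlt])
    · exact hv (by rw [hag v (by omega), N.βmul_above D hk β v hgt])
  obtain ⟨τ, rfl, hτ⟩ := N.exists_tok_of_src D hk hku v hs
  have hb' : ∀ w, k < N.src D w → β' w = β w := fun w hw => hag w (by omega)
  set c := τ.1.1.2
  have hvalid : N.CValid D (N.cl D hk c) := hτ ▸ τ.2.1
  rw [N.prodAt_eq D hk hku]
  refine Finset.prod_eq_zero (Finset.mem_univ c) ?_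
  rw [N.F_cl_eq_spec D hD hm hk hroot F hF β hval _ hb', N.spec_cl_mul D hk hkind c hvalid,
    N.any_ins_congr D hk β _ hb', if_neg]
  -- `τ` is one of the two tokens of `(k, c)`
  have hτeq : (Sum.inl τ : N.Var D) = N.tokMul D hk hkind c hvalid τ.1.2 := by
    unfold tokMul
    congr 1
    exact Subtype.ext (Prod.ext hτ rfl)
  have hst : N.βmul D hk β (Sum.inl τ) = N.sdem D hk β c := by
    rw [hτeq]
    exact N.βmul_tok D hk β c τ.1.2 _
  rw [hst] at hv
  rintro ⟨h0, h1⟩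
  have h2 : τ.1.2 = 0 ∨ τ.1.2 = 1 := by
    have := τ.1.2.isLt
    omega
  rcases h2 with h2 | h2
  · rw [hτeq, h2] at hv
    exact hv h0
  · rw [hτeq, h2] at hv
    exact hv h1

end StepMul2

section StepMul3

variable {k : ℕ} {a b : ℕ}

/-- `Rep_k = Rep_{k+1}` above the Boolean leaves. [folklore] -/
theorem Rep_succ_of_le (hku : N.u ≤ k) : N.Rep k = N.Rep (k + 1) := by
  unfold Rep
  congr 1
  ext e
  constructor <;> intro h j hj <;> [exact h j (by omega); exact absurd j.isLt (by omega)]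

/-- `βmul` on `tokMul`. [folklore] -/
theorem βmul_tokMul (hk : k < N.m) (hkind : N.kind k = NK.mul a b) (β : N.Var D → Bool)
    (c : Fin (D + 1)) (hv : N.CValid D (N.cl D hk c)) (j : Fin 2) :
    N.βmul D hk β (N.tokMul D hk hkind c hv j) = N.sdem D hk β c := by
  unfold tokMul
  exact N.βmul_tok D hk β c j _

/-- The new out-tokens of the consistent extension: both tokens of every demanded clone. [folklore] -/
theorem mem_newOut_βmul (hk : k < N.m) (hku : N.u ≤ k) (hkind : N.kind k = NK.mul a b) (hm' : 0 < N.m)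
    (hroot : N.fd (N.m - 1) ≤ D) (β : N.Var D → Bool) (v : N.Var D) :
    v ∈ N.newOut D k (N.βmul D hk β) ↔
      ∃ (c : Fin (D + 1)) (hc : N.sdem D hk β c = true) (j : Fin 2),
        v = N.tokMul D hk hkind c (N.cvalid_of_sdem D hk hm' hroot β c hc) j := by
  unfold newOut
  rw [Finset.mem_filter]
  simp only [Finset.mem_univ, true_and]
  constructor
  · rintro ⟨hb, hs, hsome⟩
    obtain ⟨τ, rfl, hτ⟩ := N.exists_tok_of_src D hk hku v hs
    have hval : N.CValid D (N.cl D hk τ.1.1.2) := hτ ▸ τ.2.1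
    have heq : (Sum.inl τ : N.Var D) = N.tokMul D hk hkind τ.1.1.2 hval τ.1.2 := by
      unfold tokMul; congr 1; exact Subtype.ext (Prod.ext hτ rfl)
    rw [heq, N.βmul_tokMul D hk hkind] at hb
    exact ⟨τ.1.1.2, hb, τ.1.2, by rw [heq]⟩
  · rintro ⟨c, hc, j, rfl⟩
    refine ⟨N.βmul_tokMul D hk hkind β c _ j ▸ hc, rfl, ?_⟩
    simp [tokMul, tgtV]

/-- The target node of a token of a product clone: `a` or `b`. [folklore] -/
theorem tgtN_tokMul (hk : k < N.m) (hkind : N.kind k = NK.mul a b) (c : Fin (D + 1))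
    (hv : N.CValid D (N.cl D hk c)) (j : Fin 2) :
    (N.tgtN D (N.tokMul D hk hkind c hv j)).1 = if j = 0 then a else b := by
  simp only [tokMul, tgtN, tgtV, Option.getD_some, tgt, cl]
  simp only [hkind, tgtOf]
  have : j = 0 ∨ j = 1 := by omega
  rcases this with rfl | rfl <;> simp

/-- `tokMul` is injective in `(c, j)`. [folklore] -/
theorem tokMul_inj (hk : k < N.m) (hkind : N.kind k = NK.mul a b) {c c' : Fin (D + 1)}
    {hv : N.CValid D (N.cl D hk c)} {hv' : N.CValid D (N.cl D hk c')}
    {j j' : Fin 2} (h : N.tokMul D hk hkind c hv j = N.tokMul D hk hkind c' hv' j') : c = c' ∧ j = j' := by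
  unfold tokMul at h
  have h1 := Subtype.ext_iff.1 (Sum.inl.inj h)
  simp only [cl, Prod.mk.injEq] at h1
  exact ⟨h1.1.2, h1.2⟩

/-- The demanded offsets of node `k`. [folklore] -/
noncomputable def Sdem (hk : k < N.m) (β : N.Var D → Bool) : Finset (Fin (D + 1)) :=
  univ.filter fun c => N.sdem D hk β c = true

/-- Membership in `Sdem`. [folklore] -/
theorem mem_Sdem (hk : k < N.m) (β : N.Var D → Bool) (c : Fin (D + 1)) :
    c ∈ N.Sdem D hk β ↔ N.sdem D hk β c = true := by
  unfold Sdem; simp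

/-- The new out-tokens as an image of (demanded offset, child position). [folklore] -/
theorem newOut_βmul_eq (hk : k < N.m) (hku : N.u ≤ k) (hkind : N.kind k = NK.mul a b) (hm' : 0 < N.m)
    (hroot : N.fd (N.m - 1) ≤ D) (β : N.Var D → Bool) :
    N.newOut D k (N.βmul D hk β) = ((N.Sdem D hk β).attach ×ˢ (univ : Finset (Fin 2))).image
      (fun p => N.tokMul D hk hkind p.1.1
        (N.cvalid_of_sdem D hk hm' hroot β p.1.1 ((N.mem_Sdem D hk β _).1 p.1.2)) p.2) := by
  ext v
  rw [N.mem_newOut_βmul D hk hku hkind hm' hroot, Finset.mem_image]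
  constructor
  · rintro ⟨c, hc, j, rfl⟩
    exact ⟨(⟨c, (N.mem_Sdem D hk β c).2 hc⟩, j),
      Finset.mem_product.2 ⟨Finset.mem_attach _ _, Finset.mem_univ _⟩, rfl⟩
  · rintro ⟨⟨⟨c, hc⟩, j⟩, -, rfl⟩
    exact ⟨c, (N.mem_Sdem D hk β c).1 hc, j, rfl⟩

/-- **The product over the new out-tokens**: `∏_{demanded c} val_e a · val_e b = ∏_{demanded c} val_e k`. [folklore] -/
theorem prod_newOut_βmul (hk : k < N.m) (hku : N.u ≤ k) (hkind : N.kind k = NK.mul a b) (hm' : 0 < N.m)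
    (hroot : N.fd (N.m - 1) ≤ D) (β : N.Var D → Bool) (e : Fin N.u → Bool) :
    ∏ v ∈ N.newOut D k (N.βmul D hk β), N.val (N.ext e) (N.tgtN D v).1 =
      ∏ _c ∈ N.Sdem D hk β, N.val (N.ext e) k := by
  rw [N.newOut_βmul_eq D hk hku hkind hm' hroot β, Finset.prod_image, Finset.prod_product,
    ← Finset.prod_attach (N.Sdem D hk β)]
  · refine Finset.prod_congr rfl fun c _ => ?_
    rw [Fin.prod_univ_two, N.tgtN_tokMul D hk hkind, N.tgtN_tokMul D hk hkind, if_pos rfl,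
      if_neg (show ¬ ((1 : Fin 2) = 0) by decide), N.val_eq (N.ext e) k hk, hkind]
    rfl
  · rintro ⟨c, j⟩ - ⟨c', j'⟩ - h
    obtain ⟨h1, h2⟩ := N.tokMul_inj D hk hkind h
    simp only [Prod.mk.injEq]
    exact ⟨Subtype.ext h1, h2⟩

/-- **`RHS_k` of the consistent extension is `RHS_{k+1}`.** [folklore] -/
theorem RHS_βmul (hk : k < N.m) (hku : N.u ≤ k) (hkind : N.kind k = NK.mul a b) (hm' : 0 < N.m)
    (hroot : N.fd (N.m - 1) ≤ D) (β : N.Var D → Bool) (hval : N.Valid D (k + 1) β) :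
    N.RHS D k (N.βmul D hk β) = N.RHS D (k + 1) β := by
  rw [N.RHS_succ_eq D k β]
  unfold RHS
  rw [N.Rep_succ_of_le hku]
  refine Finset.sum_congr rfl fun e _ => ?_
  rw [N.dem_of_ext D hk β _ (N.βmul_mem_Ext D hk β),
    Finset.prod_union (N.disjoint_demLow_newOut D k β _),
    N.prod_newOut_βmul D hk hku hkind hm' hroot β e, Finset.prod_const, N.card_demAt_eq D hk β hval]
  rfl

end StepMul3

section StepMul4

variable {k : ℕ} {a b : ℕ}

/-- A demanded offset is witnessed by a consumed demand variable targeting it. [folklore] -/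
theorem exists_dem_of_sdem (hk : k < N.m) (β : N.Var D → Bool) (c : Fin (D + 1))
    (hc : N.sdem D hk β c = true) : ∃ x ∈ N.dem D (k + 1) β, N.tgtN D x = (k, c.val) := by
  unfold sdem at hc
  obtain ⟨x, hx, hb⟩ := List.any_eq_true.1 hc
  obtain ⟨hx', ht⟩ := N.mem_demAt_of_mem_ins D hk β c x hx hb
  exact ⟨x, (Finset.mem_filter.1 hx').1, ht⟩

/-- The range of a token of the clone `(k, c)` lies inside the range of `(k, c)`. [folklore] -/
theorem rangeOf_tokMul_subset (hk : k < N.m) (hkind : N.kind k = NK.mul a b) (c : Fin (D + 1))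
    (hv : N.CValid D (N.cl D hk c)) (j : Fin 2) :
    N.rangeOf (N.tgtN D (N.tokMul D hk hkind c hv j)) ⊆ N.rangeOf (k, c.val) :=
  N.rangeOf_tgt_subset D _

/-- **The consistent extension at a product node is a valid demand across the cut `k`.** [cite: MalodPortier2008, Lemma 2] -/
theorem valid_βmul (hk : k < N.m) (hku : N.u ≤ k) (hkind : N.kind k = NK.mul a b) (hm' : 0 < N.m)
    (hroot : N.fd (N.m - 1) ≤ D) (β : N.Var D → Bool) (hval : N.Valid D (k + 1) β) :
    N.Valid D k (N.βmul D hk β) := by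
  have hlow : ∀ v ∈ N.demLow D k β, v ∈ N.dem D (k + 1) β ∧ (N.tgtN D v).1 < k := fun v hv =>
    Finset.mem_filter.1 hv
  -- a low demand and a token of a demanded clone have disjoint ranges
  have hmix : ∀ v ∈ N.demLow D k β, ∀ (c : Fin (D + 1)) (hc : N.sdem D hk β c = true) (j : Fin 2),
      Disjoint (N.rangeOf (N.tgtN D v))
        (N.rangeOf (N.tgtN D (N.tokMul D hk hkind c (N.cvalid_of_sdem D hk hm' hroot β c hc) j))) := by
    intro v hv c hc j
    obtain ⟨x, hx, hxt⟩ := N.exists_dem_of_sdem D hk β c hc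
    have hne : v ≠ x := fun h => by
      have := (hlow v hv).2
      rw [h, hxt] at this
      exact lt_irrefl _ this
    have hd := hval v (hlow v hv).1 x hx hne
    rw [hxt] at hd
    exact hd.mono_right (N.rangeOf_tokMul_subset D hk hkind c _ j)
  intro v hv w hw hne
  rw [N.dem_of_ext D hk β _ (N.βmul_mem_Ext D hk β), Finset.mem_union,
    N.mem_newOut_βmul D hk hku hkind hm' hroot] at hv hw
  rcases hv with hv | ⟨c, hc, j, rfl⟩ <;> rcases hw with hw | ⟨c', hc', j', rfl⟩
  · exact hval v (hlow v hv).1 w (hlow w hw).1 hne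
  · exact hmix v hv c' hc' j'
  · exact (hmix w hw c hc j).symm
  · by_cases hcc : c = c'
    · subst hcc
      have hjj : j ≠ j' := fun h => hne (by subst h; rfl)
      exact N.disjoint_rangeOf_mul D _ _ rfl hjj (a := a) (b := b) hkind
    · obtain ⟨x, hx, hxt⟩ := N.exists_dem_of_sdem D hk β c hc
      obtain ⟨x', hx', hxt'⟩ := N.exists_dem_of_sdem D hk β c' hc'
      have hxx : x ≠ x' := fun h => hcc (by
        rw [h, hxt'] at hxt
        exact Fin.ext (by simpa using (Prod.mk.inj hxt).2.symm))
      have hd := hval x hx x' hx' hxx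
      rw [hxt, hxt'] at hd
      exact (hd.mono_left (N.rangeOf_tokMul_subset D hk hkind c _ j)).mono_right
        (N.rangeOf_tokMul_subset D hk hkind c' _ j')

/-- **The step of the cut induction at a product node.** [cite: MalodPortier2008, Thm. 2] -/
theorem step_mul (hk : k < N.m) (hku : N.u ≤ k) (hkind : N.kind k = NK.mul a b) (hm' : 0 < N.m)
    (hroot : N.fd (N.m - 1) ≤ D) (F : Fin (N.mF D) → (N.Var D → Bool) → R)
    (hF : (N.FS D hD hm' hroot).Admissible F) (β : N.Var D → Bool) (hval : N.Valid D (k + 1) β)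
    (IH : ∀ β', N.Valid D k β' → N.W D F k β' = N.RHS D k β') :
    N.W D F (k + 1) β = N.RHS D (k + 1) β := by
  rw [N.W_succ D hD F hF.1 k β, Finset.sum_eq_single_of_mem (N.βmul D hk β) (N.βmul_mem_Ext D hk β)
    (fun β' hβ' hne => by
      rw [N.prodAt_eq_zero_of_ne D hD hm' hk hroot hku hkind F hF β hval β' hβ' hne, zero_mul]),
    N.prodAt_βmul D hD hm' hk hroot hku hkind F hF β hval, one_mul,
    IH _ (N.valid_βmul D hk hku hkind hm' hroot β hval), N.RHS_βmul D hk hku hkind hm' hroot β hval]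

end StepMul4

/-! ### Generic tokens of the node `k` -/

section TokK

variable {k : ℕ}

/-- The token `(k, c, j)` of a valid clone, `j <` arity. [folklore] -/
def tokK (hk : k < N.m) (c : Fin (D + 1)) (hv : N.CValid D (N.cl D hk c)) (j : Fin 2)
    (hj : j.val < (N.kind k).ar) : N.Var D :=
  Sum.inl ⟨(N.cl D hk c, j), hv, hj⟩

/-- `βmul` on `tokK`. [folklore] -/
theorem βmul_tokK (hk : k < N.m) (β : N.Var D → Bool) (c : Fin (D + 1)) (hv : N.CValid D (N.cl D hk c))
    (j : Fin 2) (hj : j.val < (N.kind k).ar) : N.βmul D hk β (N.tokK D hk c hv j hj) = N.sdem D hk β c :=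
  N.βmul_tok D hk β c j _

/-- The new out-tokens of `βmul β` in general: all tokens of the demanded clones. [folklore] -/
theorem mem_newOut_βK (hk : k < N.m) (hku : N.u ≤ k) (hm' : 0 < N.m) (hroot : N.fd (N.m - 1) ≤ D)
    (β : N.Var D → Bool) (v : N.Var D) :
    v ∈ N.newOut D k (N.βmul D hk β) ↔
      ∃ (c : Fin (D + 1)) (hc : N.sdem D hk β c = true) (j : Fin 2) (hj : j.val < (N.kind k).ar),
        v = N.tokK D hk c (N.cvalid_of_sdem D hk hm' hroot β c hc) j hj := by
  unfold newOut
  rw [Finset.mem_filter]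
  simp only [Finset.mem_univ, true_and]
  constructor
  · rintro ⟨hb, hs, hsome⟩
    obtain ⟨τ, rfl, hτ⟩ := N.exists_tok_of_src D hk hku v hs
    have hval : N.CValid D (N.cl D hk τ.1.1.2) := hτ ▸ τ.2.1
    have hj : τ.1.2.val < (N.kind k).ar := by
      have := τ.2.2
      rw [hτ] at this
      exact this
    have heq : (Sum.inl τ : N.Var D) = N.tokK D hk τ.1.1.2 hval τ.1.2 hj := by
      unfold tokK; congr 1; exact Subtype.ext (Prod.ext hτ rfl)
    rw [heq, N.βmul_tokK D hk] at hb
    exact ⟨τ.1.1.2, hb, τ.1.2, hj, by rw [heq]⟩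
  · rintro ⟨c, hc, j, hj, rfl⟩
    refine ⟨N.βmul_tokK D hk β c _ j hj ▸ hc, rfl, ?_⟩
    simp [tokK, tgtV]

/-- `tokK` is injective in `(c, j)`. [folklore] -/
theorem tokK_inj (hk : k < N.m) {c c' : Fin (D + 1)} {hv : N.CValid D (N.cl D hk c)}
    {hv' : N.CValid D (N.cl D hk c')} {j j' : Fin 2} {hj : j.val < (N.kind k).ar}
    {hj' : j'.val < (N.kind k).ar} (h : N.tokK D hk c hv j hj = N.tokK D hk c' hv' j' hj') :
    c = c' ∧ j = j' := by
  unfold tokK at h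
  have h1 := Subtype.ext_iff.1 (Sum.inl.inj h)
  simp only [cl, Prod.mk.injEq] at h1
  exact ⟨h1.1.2, h1.2⟩

/-- The range of a token of `(k, c)` lies inside the range of `(k, c)`. [folklore] -/
theorem rangeOf_tokK_subset (hk : k < N.m) (c : Fin (D + 1)) (hv : N.CValid D (N.cl D hk c)) (j : Fin 2)
    (hj : j.val < (N.kind k).ar) : N.rangeOf (N.tgtN D (N.tokK D hk c hv j hj)) ⊆ N.rangeOf (k, c.val) :=
  N.rangeOf_tgt_subset D _

/-- **Validity of `βmul β` across the cut `k`**, given that distinct tokens of one clone of node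
`k` have disjoint target ranges. [cite: MalodPortier2008, Lemma 2] -/
theorem valid_βK (hk : k < N.m) (hku : N.u ≤ k) (hm' : 0 < N.m) (hroot : N.fd (N.m - 1) ≤ D)
    (hsib : ∀ (τ τ' : N.Tok D), τ.1.1 = τ'.1.1 → τ.1.1.1.val = k → τ.1.2 ≠ τ'.1.2 →
      Disjoint (N.rangeOf (N.tgt D τ)) (N.rangeOf (N.tgt D τ')))
    (β : N.Var D → Bool) (hval : N.Valid D (k + 1) β) : N.Valid D k (N.βmul D hk β) := by
  have hlow : ∀ v ∈ N.demLow D k β, v ∈ N.dem D (k + 1) β ∧ (N.tgtN D v).1 < k := fun v hv =>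
    Finset.mem_filter.1 hv
  have hmix : ∀ v ∈ N.demLow D k β, ∀ (c : Fin (D + 1)) (hc : N.sdem D hk β c = true) (j : Fin 2)
      (hj : j.val < (N.kind k).ar),
      Disjoint (N.rangeOf (N.tgtN D v))
        (N.rangeOf (N.tgtN D (N.tokK D hk c (N.cvalid_of_sdem D hk hm' hroot β c hc) j hj))) := by
    intro v hv c hc j hj
    obtain ⟨x, hx, hxt⟩ := N.exists_dem_of_sdem D hk β c hc
    have hne : v ≠ x := fun h => by
      have := (hlow v hv).2
      rw [h, hxt] at this
      exact lt_irrefl _ this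
    have hd := hval v (hlow v hv).1 x hx hne
    rw [hxt] at hd
    exact hd.mono_right (N.rangeOf_tokK_subset D hk c _ j hj)
  intro v hv w hw hne
  rw [N.dem_of_ext D hk β _ (N.βmul_mem_Ext D hk β), Finset.mem_union,
    N.mem_newOut_βK D hk hku hm' hroot] at hv hw
  rcases hv with hv | ⟨c, hc, j, hj, rfl⟩ <;> rcases hw with hw | ⟨c', hc', j', hj', rfl⟩
  · exact hval v (hlow v hv).1 w (hlow w hw).1 hne
  · exact hmix v hv c' hc' j' hj'
  · exact (hmix w hw c hc j hj).symm
  · by_cases hcc : c = c'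
    · subst hcc
      have hjj : j ≠ j' := fun h => hne (by subst h; rfl)
      exact hsib _ _ rfl rfl hjj
    · obtain ⟨x, hx, hxt⟩ := N.exists_dem_of_sdem D hk β c hc
      obtain ⟨x', hx', hxt'⟩ := N.exists_dem_of_sdem D hk β c' hc'
      have hxx : x ≠ x' := fun h => hcc (by
        rw [h, hxt'] at hxt
        exact Fin.ext (by simpa using (Prod.mk.inj hxt).2.symm))
      have hd := hval x hx x' hx' hxx
      rw [hxt, hxt'] at hd
      exact (hd.mono_left (N.rangeOf_tokK_subset D hk c _ j hj)).mono_right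
        (N.rangeOf_tokK_subset D hk c' _ j' hj')

/-- If two extensions differ, they differ at a token of a valid clone of node `k`. [folklore] -/
theorem exists_tokK_of_ne (hk : k < N.m) (hku : N.u ≤ k) (β β' : N.Var D → Bool) (hβ' : β' ∈ N.Ext D k β)
    (hne : β' ≠ N.βmul D hk β) :
    ∃ (c : Fin (D + 1)) (hv : N.CValid D (N.cl D hk c)) (j : Fin 2) (hj : j.val < (N.kind k).ar),
      β' (N.tokK D hk c hv j hj) ≠ N.sdem D hk β c := by
  unfold Ext at hβ'
  rw [Finset.mem_filter] at hβ'
  obtain ⟨-, hag, hzero⟩ := hβ'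
  obtain ⟨v, hv⟩ : ∃ v, β' v ≠ N.βmul D hk β v := Function.ne_iff.1 hne
  have hs : N.src D v = k := by
    by_contra hs
    rcases Nat.lt_or_gt_of_ne hs with hlt | hgt
    · exact hv (by rw [hzero v hlt, N.βmul_below D hk β v hlt])
    · exact hv (by rw [hag v (by omega), N.βmul_above D hk β v hgt])
  obtain ⟨τ, rfl, hτ⟩ := N.exists_tok_of_src D hk hku v hs
  have hvalid : N.CValid D (N.cl D hk τ.1.1.2) := hτ ▸ τ.2.1
  have hj : τ.1.2.val < (N.kind k).ar := by
    have := τ.2.2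
    rw [hτ] at this
    exact this
  have hτeq : (Sum.inl τ : N.Var D) = N.tokK D hk τ.1.1.2 hvalid τ.1.2 hj := by
    unfold tokK; congr 1; exact Subtype.ext (Prod.ext hτ rfl)
  refine ⟨τ.1.1.2, hvalid, τ.1.2, hj, ?_⟩
  rw [← hτeq, ← N.βmul_tokK D hk β _ hvalid τ.1.2 hj, ← hτeq]
  exact hv

/-- Members of `Ext` agree with `β` strictly above `k`. [folklore] -/
theorem agree_of_mem_Ext (β β' : N.Var D → Bool) (hβ' : β' ∈ N.Ext D k β) :
    ∀ v, k < N.src D v → β' v = β v := by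
  unfold Ext at hβ'
  rw [Finset.mem_filter] at hβ'
  exact fun v hv => hβ'.2.1 v (by omega)

end TokK

/-! ### The step at a coefficient node -/

section StepPass

variable {k : ℕ} {cf : R} {a : ℕ}

/-- The value of a valid coefficient clone factor. [folklore] -/
theorem spec_cl_pass (hk : k < N.m) (hkind : N.kind k = NK.pass cf a) (c : Fin (D + 1))
    (hv : N.CValid D (N.cl D hk c)) (b' : N.Var D → Bool) :
    (N.cloneKind D (N.cl D hk c)).spec b' =
      if (N.ins D (N.cl D hk c)).any b' then
        (if b' (N.tokK D hk c hv 0 (by rw [hkind]; exact Nat.zero_lt_one)) then cf else 0)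
      else (if b' (N.tokK D hk c hv 0 (by rw [hkind]; exact Nat.zero_lt_one)) then 0 else 1) := by
  rw [N.cloneKind_eq D _ hv (show N.kind (N.cl D hk c).1.val = NK.pass cf a from hkind)]
  rfl

/-- `prodAt` of the consistent extension at a coefficient node: `cf^{#demanded}`. [folklore] -/
theorem prodAt_βpass (hk : k < N.m) (hku : N.u ≤ k) (hkind : N.kind k = NK.pass cf a) (hm' : 0 < N.m)
    (hroot : N.fd (N.m - 1) ≤ D) (F : Fin (N.mF D) → (N.Var D → Bool) → R)
    (hF : (N.FS D hD hm' hroot).Admissible F) (β : N.Var D → Bool) (hval : N.Valid D (k + 1) β) :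
    N.prodAt D F k (N.βmul D hk β) = cf ^ (N.Sdem D hk β).card := by
  rw [N.prodAt_eq D hk hku]
  have : ∀ c : Fin (D + 1), F (N.enc D (Sum.inl (N.cl D hk c))) (N.βmul D hk β) =
      if N.sdem D hk β c = true then cf else 1 := by
    intro c
    rw [N.F_cl_eq_spec D hD hm' hk hroot F hF β hval _ (fun v hv => N.βmul_above D hk β v hv)]
    by_cases hv : N.CValid D (N.cl D hk c)
    · rw [N.spec_cl_pass D hk hkind c hv, N.any_ins_congr D hk β _ (fun v hv => N.βmul_above D hk β v hv),
        N.βmul_tokK D hk]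
      cases N.sdem D hk β c <;> simp
    · rw [N.cloneKind_of_not D _ hv]
      have hs : N.sdem D hk β c = false := by
        by_contra h
        exact hv (N.cvalid_of_sdem D hk hm' hroot β c (by simpa using h))
      simp [FKind.spec, hs]
  simp_rw [this]
  rw [Finset.prod_ite, Finset.prod_const_one, mul_one, Finset.prod_const]
  rfl

/-- Every other extension kills a coefficient clone factor. [folklore] -/
theorem prodAt_eq_zero_of_ne_pass (hk : k < N.m) (hku : N.u ≤ k) (hkind : N.kind k = NK.pass cf a)
    (hm' : 0 < N.m) (hroot : N.fd (N.m - 1) ≤ D) (F : Fin (N.mF D) → (N.Var D → Bool) → R)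
    (hF : (N.FS D hD hm' hroot).Admissible F) (β : N.Var D → Bool) (hval : N.Valid D (k + 1) β)
    (β' : N.Var D → Bool) (hβ' : β' ∈ N.Ext D k β) (hne : β' ≠ N.βmul D hk β) :
    N.prodAt D F k β' = 0 := by
  obtain ⟨c, hvalid, j, hj, hv⟩ := N.exists_tokK_of_ne D hk hku β β' hβ' hne
  have hb' := N.agree_of_mem_Ext D β β' hβ'
  rw [N.prodAt_eq D hk hku]
  refine Finset.prod_eq_zero (Finset.mem_univ c) ?_
  rw [N.F_cl_eq_spec D hD hm' hk hroot F hF β hval _ hb', N.spec_cl_pass D hk hkind c hvalid,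
    N.any_ins_congr D hk β _ hb']
  have hj0 : j = 0 := by
    have : j.val < 1 := by rw [hkind] at hj; exact hj
    exact Fin.ext (by simp only [Fin.val_zero]; omega)
  subst hj0
  revert hv
  cases β' (N.tokK D hk c hvalid 0 hj) <;> cases N.sdem D hk β c <;> simp

/-- The product over the new out-tokens at a coefficient node: `∏_{demanded} val_e a`. [folklore] -/
theorem prod_newOut_βpass (hk : k < N.m) (hku : N.u ≤ k) (hkind : N.kind k = NK.pass cf a) (hm' : 0 < N.m)
    (hroot : N.fd (N.m - 1) ≤ D) (β : N.Var D → Bool) (e : Fin N.u → Bool) :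
    ∏ v ∈ N.newOut D k (N.βmul D hk β), N.val (N.ext e) (N.tgtN D v).1 =
      ∏ _c ∈ N.Sdem D hk β, N.val (N.ext e) a := by
  have h0 : (0 : Fin 2).val < (N.kind k).ar := by rw [hkind]; exact Nat.zero_lt_one
  have himg : N.newOut D k (N.βmul D hk β) = (N.Sdem D hk β).attach.image
      (fun p => N.tokK D hk p.1 (N.cvalid_of_sdem D hk hm' hroot β p.1 ((N.mem_Sdem D hk β _).1 p.2)) 0 h0) := by
    ext v
    rw [N.mem_newOut_βK D hk hku hm' hroot, Finset.mem_image]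
    constructor
    · rintro ⟨c, hc, j, hj, rfl⟩
      have hj0 : j = 0 := by
        have : j.val < 1 := by rw [hkind] at hj; exact hj
        exact Fin.ext (by simp only [Fin.val_zero]; omega)
      subst hj0
      exact ⟨⟨c, (N.mem_Sdem D hk β c).2 hc⟩, Finset.mem_attach _ _, rfl⟩
    · rintro ⟨⟨c, hc⟩, -, rfl⟩
      exact ⟨c, (N.mem_Sdem D hk β c).1 hc, 0, h0, rfl⟩
  rw [himg, Finset.prod_image, ← Finset.prod_attach (N.Sdem D hk β)]
  · refine Finset.prod_congr rfl fun c _ => ?_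
    simp only [tokK, tgtN, tgtV, Option.getD_some, tgt, cl, hkind, tgtOf]
  · rintro c - c' - h
    exact Subtype.ext (N.tokK_inj D hk h).1

/-- **The step of the cut induction at a coefficient node.** [cite: MalodPortier2008, Thm. 2] -/
theorem step_pass (hk : k < N.m) (hku : N.u ≤ k) (hkind : N.kind k = NK.pass cf a) (hm' : 0 < N.m)
    (hroot : N.fd (N.m - 1) ≤ D) (F : Fin (N.mF D) → (N.Var D → Bool) → R)
    (hF : (N.FS D hD hm' hroot).Admissible F) (β : N.Var D → Bool) (hval : N.Valid D (k + 1) β)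
    (IH : ∀ β', N.Valid D k β' → N.W D F k β' = N.RHS D k β') :
    N.W D F (k + 1) β = N.RHS D (k + 1) β := by
  have hsib : ∀ (τ τ' : N.Tok D), τ.1.1 = τ'.1.1 → τ.1.1.1.val = k → τ.1.2 ≠ τ'.1.2 →
      Disjoint (N.rangeOf (N.tgt D τ)) (N.rangeOf (N.tgt D τ')) := by
    intro τ τ' hττ' hτk hj
    exfalso
    have h1 : τ.1.2.val < 1 := by have := τ.2.2; rw [hτk, hkind] at this; exact this
    have h2 : τ'.1.2.val < 1 := by have := τ'.2.2; rw [← hττ', hτk, hkind] at this; exact this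
    exact hj (Fin.ext (by omega))
  rw [N.W_succ D hD F hF.1 k β, Finset.sum_eq_single_of_mem (N.βmul D hk β) (N.βmul_mem_Ext D hk β)
    (fun β' hβ' hne => by
      rw [N.prodAt_eq_zero_of_ne_pass D hD hk hku hkind hm' hroot F hF β hval β' hβ' hne, zero_mul]),
    N.prodAt_βpass D hD hk hku hkind hm' hroot F hF β hval,
    IH _ (N.valid_βK D hk hku hm' hroot hsib β hval), N.RHS_succ_eq D k β]
  unfold RHS
  rw [N.Rep_succ_of_le hku, Finset.mul_sum]
  refine Finset.sum_congr rfl fun e _ => ?_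
  rw [N.dem_of_ext D hk β _ (N.βmul_mem_Ext D hk β),
    Finset.prod_union (N.disjoint_demLow_newOut D k β _),
    N.prod_newOut_βpass D hk hku hkind hm' hroot β e, Finset.prod_const, N.card_demAt_eq D hk β hval,
    N.val_eq (N.ext e) k hk, hkind]
  show cf ^ _ * (_ * N.val (N.ext e) a ^ _) = _ * (cf * N.val (N.ext e) a) ^ _
  rw [mul_pow]
  unfold Sdem
  ring

end StepPass

/-! ### The step at a ring leaf -/

section StepLeaf

variable {k : ℕ} {ℓ : R}

/-- At a node of arity `0` the consistent extension is the only extension. [folklore] -/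
theorem eq_βmul_of_ar_zero (hk : k < N.m) (hku : N.u ≤ k) (har : (N.kind k).ar = 0)
    (β β' : N.Var D → Bool) (hβ' : β' ∈ N.Ext D k β) : β' = N.βmul D hk β := by
  by_contra hne
  obtain ⟨c, hv, j, hj, -⟩ := N.exists_tokK_of_ne D hk hku β β' hβ' hne
  rw [har] at hj
  exact Nat.not_lt_zero _ hj

/-- At a node of arity `0` there are no new out-tokens. [folklore] -/
theorem newOut_eq_empty_of_ar_zero (hk : k < N.m) (hku : N.u ≤ k) (har : (N.kind k).ar = 0) (hm' : 0 < N.m)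
    (hroot : N.fd (N.m - 1) ≤ D) (β : N.Var D → Bool) : N.newOut D k (N.βmul D hk β) = ∅ := by
  ext v
  rw [N.mem_newOut_βK D hk hku hm' hroot]
  simp only [Finset.notMem_empty, iff_false, not_exists]
  intro c hc j hj
  rw [har] at hj
  exact absurd hj (Nat.not_lt_zero _)

/-- `prodAt` of the consistent extension at a ring leaf: `ℓ^{#demanded}`. [folklore] -/
theorem prodAt_βleaf (hk : k < N.m) (hku : N.u ≤ k) (hkind : N.kind k = NK.leaf ℓ) (hm' : 0 < N.m)
    (hroot : N.fd (N.m - 1) ≤ D) (F : Fin (N.mF D) → (N.Var D → Bool) → R)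
    (hF : (N.FS D hD hm' hroot).Admissible F) (β : N.Var D → Bool) (hval : N.Valid D (k + 1) β) :
    N.prodAt D F k (N.βmul D hk β) = ℓ ^ (N.Sdem D hk β).card := by
  rw [N.prodAt_eq D hk hku]
  have : ∀ c : Fin (D + 1), F (N.enc D (Sum.inl (N.cl D hk c))) (N.βmul D hk β) =
      if N.sdem D hk β c = true then ℓ else 1 := by
    intro c
    rw [N.F_cl_eq_spec D hD hm' hk hroot F hF β hval _ (fun v hv => N.βmul_above D hk β v hv)]
    by_cases hv : N.CValid D (N.cl D hk c)
    · rw [N.cloneKind_eq D _ hv (show N.kind (N.cl D hk c).1.val = NK.leaf ℓ from hkind)]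
      show (if (N.ins D (N.cl D hk c)).any (N.βmul D hk β) then ℓ else 1) = _
      rw [N.any_ins_congr D hk β _ (fun v hv => N.βmul_above D hk β v hv)]
    · rw [N.cloneKind_of_not D _ hv]
      have hs : N.sdem D hk β c = false := by
        by_contra h
        exact hv (N.cvalid_of_sdem D hk hm' hroot β c (by simpa using h))
      simp [FKind.spec, hs]
  simp_rw [this]
  rw [Finset.prod_ite, Finset.prod_const_one, mul_one, Finset.prod_const]
  rfl

/-- **The step of the cut induction at a ring leaf.** [cite: MalodPortier2008, Thm. 2] -/
theorem step_leaf (hk : k < N.m) (hku : N.u ≤ k) (hkind : N.kind k = NK.leaf ℓ) (hm' : 0 < N.m)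
    (hroot : N.fd (N.m - 1) ≤ D) (F : Fin (N.mF D) → (N.Var D → Bool) → R)
    (hF : (N.FS D hD hm' hroot).Admissible F) (β : N.Var D → Bool) (hval : N.Valid D (k + 1) β)
    (IH : ∀ β', N.Valid D k β' → N.W D F k β' = N.RHS D k β') :
    N.W D F (k + 1) β = N.RHS D (k + 1) β := by
  have har : (N.kind k).ar = 0 := by rw [hkind]; rfl
  have hsib : ∀ (τ τ' : N.Tok D), τ.1.1 = τ'.1.1 → τ.1.1.1.val = k → τ.1.2 ≠ τ'.1.2 →
      Disjoint (N.rangeOf (N.tgt D τ)) (N.rangeOf (N.tgt D τ')) := by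
    intro τ τ' _ hτk _
    exfalso
    have h1 : τ.1.2.val < 0 := by have := τ.2.2; rw [hτk, har] at this; exact this
    exact Nat.not_lt_zero _ h1
  rw [N.W_succ D hD F hF.1 k β, Finset.sum_eq_single_of_mem (N.βmul D hk β) (N.βmul_mem_Ext D hk β)
    (fun β' hβ' hne => absurd (N.eq_βmul_of_ar_zero D hk hku har β β' hβ') hne),
    N.prodAt_βleaf D hD hk hku hkind hm' hroot F hF β hval,
    IH _ (N.valid_βK D hk hku hm' hroot hsib β hval), N.RHS_succ_eq D k β]
  unfold RHS
  rw [N.Rep_succ_of_le hku, Finset.mul_sum]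
  refine Finset.sum_congr rfl fun e _ => ?_
  rw [N.dem_of_ext D hk β _ (N.βmul_mem_Ext D hk β),
    Finset.prod_union (N.disjoint_demLow_newOut D k β _),
    N.newOut_eq_empty_of_ar_zero D hk hku har hm' hroot β, Finset.prod_empty, mul_one,
    N.card_demAt_eq D hk β hval, N.val_eq (N.ext e) k hk, hkind]
  show ℓ ^ _ * _ = _ * ℓ ^ _
  unfold Sdem
  ring

end StepLeaf

end NCirc

end Literature.Computability.AlgebraicComplexity
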